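/-
Copyright (c) 2026 the pub-hodgecm-mathlib formalisation cell (harness21).  Prover seat hodgecm-mathlib-F0P3a-p03 (g21), 2026-09-02 (LH7 leaf ED. 3 road, (O8b♭) local,
«DET-SCALAR» road: the (SU-GEN) input — at every finite place the norm-one-determinant part of `U(antidiag(1,1))(F_v)` is generated by compact subgroups).
-/
import Literature.NumberTheory.Automorphic.UnitaryOneOneTransvections        -- ★ p850490 (this seat): `UnitaryOneOne.mem_closure_isCompact_of_det_eq_one`
import Literature.NumberTheory.Automorphic.LocalUnitaryGroupCongr            -- ★ `localPiNonsplitEquiv`, `coe_localPiNonsplitEquiv_apply`, `isUnit_placeForm_of_isUnit_det` (+ ★ `localPiSplitEquiv`, ★ `PlacesOver.nonempty`)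
import Literature.GroupTheory.DicksonGLTwoTransvections                      -- ★ `DicksonGL2.exists_word_of_det_eq_one`
import HarnessLib

/-!
# `U(antidiag(1,1))(F_v)`: at every finite place `v`, split or not, the elements with norm-one determinant lie in the subgroup generated by the compact subgroups

Registry: pub-hodgecm MODEL-CONSTRUCTION sub-cell, companion of ★ `UnitaryGroupSplitPlace` (`localPiSplitEquiv`), ★ `LocalUnitaryGroupCongr` (`localPiNonsplitEquiv`), ★ p850404
`GLnCompactSubgroupsGenerate` and ★ `UnitaryOneOneTransvections`.  THEOREMS ONLY: no definition, no named fact, no instance, no notation, no `sorry`.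

THE MATHEMATICS.  `E ∕ F` a quadratic extension of number fields with non-trivial automorphism `c`, `J = antidiag(1,1) ∈ M₂(E)`, `v` a finite place of `F`; `G_v := U(J)(F_v)` in the factor
form ★ `localPi E c 2 J v ≤ Π_{w ∣ v} GL₂(E_w)`, `G°_v := ⟨K ≤ G_v | K ⊆ compact⟩` (the `Subgroup.closure` of the union of the subgroups contained in compact sets — the EXACT currency of ★
`IrrClass.apply_eq_smul_of_forall_isConstituentOf_eq_of_mem_closure`).  CLAIM (SU-GEN)_v: every `u ∈ G_v` with `det u_w = 1` for all `w ∣ v` lies in `G°_v`.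
* §1 (transport) `G°` is functorial under isomorphisms of topological groups: `e x ∈ H° ⇒ x ∈ G°` for `e : G ≃ₜ* H` (`mem_closure_isCompact_of_map_mem`).
* §2 (`GL₂`) over a non-archimedean local field every `g ∈ GL₂(R)` with `det g = 1` lies in `GL₂(R)°`: `g` is a word in four transvections (★ Dickson `exists_word_of_det_eq_one`), each in a
  compact open subgroup (★ p850404 `exists_isCompact_isOpen_subgroup_transvection_mem`) (`GL2.mem_closure_isCompact_of_det_eq_one`).
* §3 SPLIT `v` (`w ∣ v` with `c w ≠ w`): `G_v ≃ₜ* GL₂(E_w)`, `u ↦ u_w` (★ `localPiSplitEquiv`); §2 + §1 (`mk_mem_closure_isCompact_of_det_eq_one_of_split`).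
* §4 NON-SPLIT `v` (`c w = w`): `G_v ≃ₜ* U(σ_w, J_w)(E_w)` (★ `localPiNonsplitEquiv`), `J_w = antidiag(1,1)`, `σ_w` the continuous extension of `c`; an anti-fixed `θ ≠ 0` of `c` stays
  anti-fixed and non-zero in `E_w`; ★ `UnitaryOneOne.mem_closure_isCompact_of_det_eq_one` + §1 (`mk_mem_closure_isCompact_of_det_eq_one_of_nonsplit`).
* §5 ALL `v`: `mk_mem_closure_isCompact_of_forall_det_eq_one` (case split on `∃ w ∣ v, c w ≠ w`; `θ := x − c x` for any `x` moved by `c`, using `c² = 1` ★ `algEquiv_mul_self_eq_one`).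
CONSUMER (cell `hodgecm-mathlib`, crux H413, line LH7, (O8b♭) local isotypy): discharges the binder `hSU` of ★ `F0P3cPKtupleU2LocalIsotypy.finRep_smoothPart_inclPlace_apply_eq_smul_of_realises₂_of_su`
at `F = L⁺`, `E = L`, `c` = complex conjugation, `J = Φ₂`.  HONEST LABEL: model plumbing ([PlatonovRapinchuk1994] §3.3, §5.1, §7.1; [Dickson1901] Ch. XII); HC_CM is proved only modulo the
printed citations of that programme until its rung 0 closes; this file proves no printed citation of it.

## References
* [PlatonovRapinchuk1994] V. Platonov, A. Rapinchuk, *Algebraic Groups and Number Theory* (1994), §3.3 (compact open subgroups), §5.1 (local factors of adelic groups), §7.1.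
* [Dickson1901] L. E. Dickson, *Linear Groups* (1901), Ch. XII.
* [BushnellHenniart2006] C. J. Bushnell, G. Henniart, *The local Langlands conjecture for GL(2)* (2006), §7.2.
* [Rogawski1990] J. D. Rogawski, *Automorphic Representations of Unitary Groups in Three Variables* (1990), §1.9, §13.3 p. 203.
-/

set_option autoImplicit false

noncomputable section

open Matrix NumberField IsDedekindDomain

namespace Literature.NumberTheory.Automorphic

/-! ## §1 Transport of `G°` along an isomorphism of topological groups -/

/-- **`G° = ⟨compact subgroups⟩` is functorial**: for an isomorphism of topological groups `e : G ≃ₜ* H` and `x ∈ G`, if `e x` lies in the subgroup closure of `⋃ {K ≤ H | IsCompact ↑K}` then `x`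
lies in the subgroup closure of `⋃ {K ≤ G | IsCompact ↑K}` (a compact `K ≤ H` pulls back to the compact `e⁻¹(K) ≤ G`). [cite: PlatonovRapinchuk1994, §3.3] -/
theorem mem_closure_isCompact_of_map_mem {G H : Type*} [Group G] [Group H] [TopologicalSpace G] [TopologicalSpace H] (e : G ≃ₜ* H) {x : G}
    (hx : e x ∈ Subgroup.closure (⋃ K ∈ {K : Subgroup H | IsCompact (K : Set H)}, (K : Set H))) :
    x ∈ Subgroup.closure (⋃ K ∈ {K : Subgroup G | IsCompact (K : Set G)}, (K : Set G)) := by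
  rw [← e.symm_apply_apply x]
  refine Subgroup.closure_induction (p := fun y _ => e.symm y ∈ Subgroup.closure (⋃ K ∈ {K : Subgroup G | IsCompact (K : Set G)}, (K : Set G)))
    (fun y hy => ?_) (by rw [map_one]; exact one_mem _) (fun y z _ _ hy hz => by rw [map_mul]; exact mul_mem hy hz)
    (fun y _ hy => by rw [map_inv]; exact inv_mem hy) hx
  obtain ⟨K, hK, hyK⟩ := Set.mem_iUnion₂.1 hy
  refine Subgroup.subset_closure (Set.mem_iUnion₂.2 ⟨K.map e.symm.toMulEquiv.toMonoidHom, ?_, Subgroup.mem_map_of_mem _ hyK⟩)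
  change IsCompact ((K.map e.symm.toMulEquiv.toMonoidHom : Subgroup G) : Set G)
  rw [Subgroup.coe_map]
  exact hK.image e.symm.continuous

/-! ## §2 `GL₂` over a non-archimedean local field: determinant one ⇒ in `GL₂°` -/

/-- **Every `g ∈ GL₂(R)` with `det g = 1` lies in the subgroup generated by the compact subgroups of `GL₂(R)`** (`R` a non-archimedean local field): `g = L(a) · U(r) · L(c) · U(s)` is a word in
transvections (★ Dickson `exists_word_of_det_eq_one`), and every transvection lies in a compact open subgroup (★ p850404 `exists_isCompact_isOpen_subgroup_transvection_mem`).
[cite: Dickson1901, Ch. XII] [cite: PlatonovRapinchuk1994, §3.3] [cite: BushnellHenniart2006, §7.2] -/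
theorem GL2.mem_closure_isCompact_of_det_eq_one {R : Type*} [Field R] [ValuativeRel R] [TopologicalSpace R] [IsNonarchimedeanLocalField R] (g : GL (Fin 2) R)
    (hg : (g : Matrix (Fin 2) (Fin 2) R).det = 1) :
    g ∈ Subgroup.closure (⋃ K ∈ {K : Subgroup (GL (Fin 2) R) | IsCompact (K : Set (GL (Fin 2) R))}, (K : Set (GL (Fin 2) R))) := by
  obtain ⟨a, r, c, s, hw⟩ := Literature.GroupTheory.DicksonGL2.exists_word_of_det_eq_one (g : Matrix (Fin 2) (Fin 2) R) hg
  have hletter : ∀ t : TransvectionStruct (Fin 2) R, (⟨t.toMatrix, t.inv.toMatrix, t.mul_inv, t.inv_mul⟩ : GL (Fin 2) R) ∈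
      Subgroup.closure (⋃ K ∈ {K : Subgroup (GL (Fin 2) R) | IsCompact (K : Set (GL (Fin 2) R))}, (K : Set (GL (Fin 2) R))) := fun t => by
    obtain ⟨K, hK, -, htK⟩ := Literature.NumberTheory.LocalFields.exists_isCompact_isOpen_subgroup_transvection_mem (F := R) t
    exact Subgroup.subset_closure (Set.mem_iUnion₂.2 ⟨K, hK, htK⟩)
  have hgw : g = (⟨TransvectionStruct.toMatrix ⟨1, 0, by decide, a⟩, TransvectionStruct.toMatrix (TransvectionStruct.inv ⟨1, 0, by decide, a⟩),
        TransvectionStruct.mul_inv _, TransvectionStruct.inv_mul _⟩ : GL (Fin 2) R) *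
      ((⟨TransvectionStruct.toMatrix ⟨0, 1, by decide, r⟩, TransvectionStruct.toMatrix (TransvectionStruct.inv ⟨0, 1, by decide, r⟩),
          TransvectionStruct.mul_inv _, TransvectionStruct.inv_mul _⟩ : GL (Fin 2) R) *
        (⟨TransvectionStruct.toMatrix ⟨1, 0, by decide, c⟩, TransvectionStruct.toMatrix (TransvectionStruct.inv ⟨1, 0, by decide, c⟩),
          TransvectionStruct.mul_inv _, TransvectionStruct.inv_mul _⟩ : GL (Fin 2) R) *
        (⟨TransvectionStruct.toMatrix ⟨0, 1, by decide, s⟩, TransvectionStruct.toMatrix (TransvectionStruct.inv ⟨0, 1, by decide, s⟩),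
          TransvectionStruct.mul_inv _, TransvectionStruct.inv_mul _⟩ : GL (Fin 2) R)) :=
    Units.ext (by rw [Units.val_mul, Units.val_mul, Units.val_mul]; exact hw)
  rw [hgw]
  exact mul_mem (hletter _) (mul_mem (mul_mem (hletter _) (hletter _)) (hletter _))

namespace UnitaryGroup

variable (F E : Type) [Field F] [NumberField F] [Field E] [NumberField E] [Algebra F E] [Algebra.IsQuadraticExtension F E]
variable (c : E ≃ₐ[F] E) (J : Matrix (Fin 2) (Fin 2) E)

variable {F}

omit [NumberField F] [NumberField E] [Algebra.IsQuadraticExtension F E] in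
/-- `antidiag(1,1)` is `c`-hermitian (plumbing). [folklore] -/
private theorem antidiag_hermitian {J : Matrix (Fin 2) (Fin 2) E} (hJ2 : J = !![0, 1; 1, 0]) : (J.map c)ᵀ = J := by
  subst hJ2
  ext i j
  fin_cases i <;> fin_cases j <;> simp

omit [NumberField F] [NumberField E] [Algebra.IsQuadraticExtension F E] in
/-- `antidiag(1,1)` is invertible (plumbing). [folklore] -/
private theorem antidiag_isUnit_det {J : Matrix (Fin 2) (Fin 2) E} (hJ2 : J = !![0, 1; 1, 0]) : IsUnit J.det := by
  subst hJ2
  rw [Matrix.det_fin_two_of]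
  norm_num

omit [NumberField F] [Algebra.IsQuadraticExtension F E] in
/-- `antidiag(1,1)` stays `antidiag(1,1)` over `E_w` (plumbing). [folklore] -/
private theorem placeForm_antidiag {J : Matrix (Fin 2) (Fin 2) E} (hJ2 : J = !![0, 1; 1, 0]) (w : HeightOneSpectrum (𝓞 E)) :
    placeForm J w = !![0, 1; 1, 0] := by
  subst hJ2
  ext i j
  fin_cases i <;> fin_cases j <;> simp [Matrix.map_apply]

/-! ## §3 Split places -/

/-- **(SU-GEN) at a SPLIT place.**  `w ∣ v` with `c w ≠ w`, `J = antidiag(1,1)`: every `u ∈ U(J)(F_v)` (factor form, membership `hu`) with `det u_w = 1` lies in `U(J)(F_v)° = ⟨compact subgroups⟩` —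
`u ↦ u_w` is `U(J)(F_v) ≃ₜ* GL₂(E_w)` (★ `localPiSplitEquiv`) and §2 ∕ §1 apply. [cite: PlatonovRapinchuk1994, §3.3; §5.1] [cite: Dickson1901, Ch. XII] -/
theorem mk_mem_closure_isCompact_of_det_eq_one_of_split (hc : c ≠ 1) {J : Matrix (Fin 2) (Fin 2) E} (hJ2 : J = !![0, 1; 1, 0]) {v : HeightOneSpectrum (𝓞 F)}
    (w : PlacesOver E v) (hw : c • w.1 ≠ w.1) (u : LocalGLPi E 2 v) (hu : u ∈ localPi E c 2 J v)
    (hdet : ((u w : GL (Fin 2) (w.1.adicCompletion E)) : Matrix (Fin 2) (Fin 2) (w.1.adicCompletion E)).det = 1) :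
    (⟨u, hu⟩ : ↥(localPi E c 2 J v)) ∈
      Subgroup.closure (⋃ K ∈ {K : Subgroup ↥(localPi E c 2 J v) | IsCompact (K : Set ↥(localPi E c 2 J v))}, (K : Set ↥(localPi E c 2 J v))) :=
  mem_closure_isCompact_of_map_mem (localPiSplitEquiv c J hc (antidiag_hermitian E c hJ2) w hw (isUnit_placeForm_of_isUnit_det (antidiag_isUnit_det E hJ2) w.1))
    (GL2.mem_closure_isCompact_of_det_eq_one _ (by rw [localPiSplitEquiv_apply]; exact hdet))

/-! ## §4 Non-split places -/

omit [NumberField F] [Algebra.IsQuadraticExtension F E] in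
/-- the coercion `E → E_w` is the algebra map (plumbing). [folklore] -/
private theorem coe_eq_algebraMap (w : HeightOneSpectrum (𝓞 E)) (x : E) : ((x : E) : w.adicCompletion E) = algebraMap E (w.adicCompletion E) x := by
  rw [IsDedekindDomain.HeightOneSpectrum.algebraMap_adicCompletion]
  rfl

omit [NumberField F] [Algebra.IsQuadraticExtension F E] in
/-- an anti-fixed element of `c` stays anti-fixed under `σ_w` in `E_w` (`σ_w` extends `c`, ★ `galAdicCompletionMap_coe_algEquiv`). [folklore] -/
private theorem galAdicCompletionMap_algebraMap_of_map_eq_neg {v : HeightOneSpectrum (𝓞 F)} (w : PlacesOver E v) (hw : c • w.1 = w.1) {θ : E} (hθ : c θ = -θ) :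
    galAdicCompletionMap (L := E) c hw (algebraMap E (w.1.adicCompletion E) θ) = -algebraMap E (w.1.adicCompletion E) θ := by
  rw [← coe_eq_algebraMap, galAdicCompletionMap_coe_algEquiv (σ := c) (h := hw) (x := θ), hθ, coe_eq_algebraMap, coe_eq_algebraMap, map_neg]

/-- **(SU-GEN) at a NON-SPLIT place.**  `w ∣ v` with `c w = w`, `J = antidiag(1,1)`, `θ ≠ 0` with `c θ = −θ`: every `u ∈ U(J)(F_v)` (factor form) with `det u_w = 1` lies in
`U(J)(F_v)° = ⟨compact subgroups⟩` — `u ↦ u_w` is `U(J)(F_v) ≃ₜ* U(σ_w, antidiag(1,1))(E_w)` (★ `localPiNonsplitEquiv`), where ★ `UnitaryOneOne.mem_closure_isCompact_of_det_eq_one` applies with the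
anti-fixed `θ ⊗ 1 ≠ 0`; then §1. [cite: PlatonovRapinchuk1994, §3.3; §5.1; §7.1] [cite: Rogawski1990, §1.9] -/
theorem mk_mem_closure_isCompact_of_det_eq_one_of_nonsplit (hc : c ≠ 1) {J : Matrix (Fin 2) (Fin 2) E} (hJ2 : J = !![0, 1; 1, 0]) {v : HeightOneSpectrum (𝓞 F)}
    (w : PlacesOver E v) (hw : c • w.1 = w.1) {θ : E} (hθ : c θ = -θ) (hθ0 : θ ≠ 0) (u : LocalGLPi E 2 v) (hu : u ∈ localPi E c 2 J v)
    (hdet : ((u w : GL (Fin 2) (w.1.adicCompletion E)) : Matrix (Fin 2) (Fin 2) (w.1.adicCompletion E)).det = 1) :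
    (⟨u, hu⟩ : ↥(localPi E c 2 J v)) ∈
      Subgroup.closure (⋃ K ∈ {K : Subgroup ↥(localPi E c 2 J v) | IsCompact (K : Set ↥(localPi E c 2 J v))}, (K : Set ↥(localPi E c 2 J v))) :=
  mem_closure_isCompact_of_map_mem (localPiNonsplitEquiv c J hc w hw)
    (UnitaryOneOne.mem_closure_isCompact_of_det_eq_one (galAdicCompletionMap (L := E) c hw) (continuous_galAdicCompletionMap E c hw)
      (placeForm_antidiag E hJ2 w.1) (algebraMap E (w.1.adicCompletion E) θ) (galAdicCompletionMap_algebraMap_of_map_eq_neg E c w hw hθ)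
      ((map_ne_zero _).2 hθ0) _ (by rw [coe_localPiNonsplitEquiv_apply]; exact hdet))

/-! ## §5 All finite places -/

/-- **(SU-GEN) AT EVERY FINITE PLACE.**  `E ∕ F` quadratic, `c ≠ 1`, `J = antidiag(1,1)`: for every finite place `v` of `F`, every `u ∈ U(J)(F_v)` (factor form ★ `localPi E c 2 J v`) all of whose
components have determinant `1` lies in the subgroup closure of `⋃ {K ≤ U(J)(F_v) | IsCompact ↑K}` (§3 if some `w ∣ v` is moved by `c`; else §4 with `θ := x − c x` for an `x` moved by `c`,
anti-fixed because `c² = 1`, ★ `algEquiv_mul_self_eq_one`).  The `hSU` binder of the (O8b♭) local isotypy, discharged. [cite: PlatonovRapinchuk1994, §3.3; §5.1; §7.1] [cite: Dickson1901, Ch. XII] -/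
theorem mk_mem_closure_isCompact_of_forall_det_eq_one (hc : c ≠ 1) {J : Matrix (Fin 2) (Fin 2) E} (hJ2 : J = !![0, 1; 1, 0]) (v : HeightOneSpectrum (𝓞 F))
    (u : LocalGLPi E 2 v) (hu : u ∈ localPi E c 2 J v)
    (hdet : ∀ w : PlacesOver E v, ((u w : GL (Fin 2) (w.1.adicCompletion E)) : Matrix (Fin 2) (Fin 2) (w.1.adicCompletion E)).det = 1) :
    (⟨u, hu⟩ : ↥(localPi E c 2 J v)) ∈
      Subgroup.closure (⋃ K ∈ {K : Subgroup ↥(localPi E c 2 J v) | IsCompact (K : Set ↥(localPi E c 2 J v))}, (K : Set ↥(localPi E c 2 J v))) := by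
  by_cases hsplit : ∃ w : PlacesOver E v, c • w.1 ≠ w.1
  · obtain ⟨w, hw⟩ := hsplit
    exact mk_mem_closure_isCompact_of_det_eq_one_of_split E c hc hJ2 w hw u hu (hdet w)
  · push Not at hsplit
    obtain ⟨w⟩ := (inferInstance : Nonempty (PlacesOver E v))
    -- an element moved by `c`, and the anti-fixed `θ := x − c x ≠ 0`
    have hx : ∃ x : E, c x ≠ x := by
      by_contra h
      push Not at h
      exact hc (AlgEquiv.ext h)
    obtain ⟨x, hx⟩ := hx
    have hcc : ∀ y : E, c (c y) = y := fun y => by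
      rw [← AlgEquiv.mul_apply, algEquiv_mul_self_eq_one F hc, AlgEquiv.one_apply]
    exact mk_mem_closure_isCompact_of_det_eq_one_of_nonsplit E c hc hJ2 w (hsplit w) (θ := x - c x)
      (by rw [map_sub, hcc, neg_sub]) (sub_ne_zero.2 hx.symm) u hu (hdet w)

end UnitaryGroup

end Literature.NumberTheory.Automorphic

end
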